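import Summits.CriticalPhenomena.CardyFormulaZ2.Theorems.CardyBoundaryCoulombGasBoundaryDefectGaussianRStubRealisabilityPart21
import Summits.CriticalPhenomena.CardyFormulaZ2.Theorems.CardyBoundaryCoulombGasBoundaryDefectGaussianRStubRealisabilityPart7
import Literature.Probability.LatticeModels.CollarLegModelRainbow

/-!
# Stub `stub_realisability` of line `rainbow-monomials-in-excursion-kernels` — Part 22:
# strand ends of the collar walk (III): the `endsAt` table and the TAGS of `strandEnds`
# (crux `BoundaryDefectGaussianR`, stmt-CriticalPhenomena-14132; insertion dictionary D2, layer 3b)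

`LegInsertionData.strandEnds ι V` (`Literature.Probability.LatticeModels.CollarLegModelRainbow`) is
the finite set of ends `((corner), tag)` created along the collar walk by `endsAt`: at a dart
`(v, k)` where the level moves `ℓ → ℓ'`, a JUMP (`ℓ' = ℓ ± 2`) creates `(v, k+3)` and `(v, k)`
tagged `min ℓ ((ℓ+ℓ')/2)`, `min ℓ' ((ℓ+ℓ')/2)`, a JUNCTION (`± 1`) creates one end at the ghost
`dartTip (v, k)`: `(g, k+1)` if the arc closes, `(g, k+2)` if it opens, tagged `min ℓ ℓ'`.

* the table (`se_endsAt_nil/jump/junction`), tags of one dart lie in `[min ℓ ℓ', max ℓ ℓ')`,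
  every such tag occurs, distinct tags and distinct corners, where the corners sit
  (`se_endsAt_tag`, `se_endsAt_tag_surj`, `se_endsAt_inj`, `se_endsAt_site`);
* membership by position (`se_mem_strandEnds_iff`), the level change at an active dart
  (`se_active_delta`), and **the corner of an end determines its dart** (`se_end_index_inj`, from
  the rail uniqueness facts of Part 20 and `se_active_rail` of Part 21);
* **`se_tags_main` / registered `s14_strandEnds_tags`**: for an admissible insertion with flat
  insertion points the tags are exactly `-L ≤ m ≤ -1`, EACH CARRIED BY EXACTLY TWO ENDS (the dart
  `t < T₀` of the rising phase with `ℓ_t ≤ m < ℓ_(t+1)` and the dart `t ≥ T₀` of the falling phase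
  with `ℓ_(t+1) ≤ m < ℓ_t`: discrete intermediate values `se_ivt_up/down` and monotonicity
  `se_mono_up/down` on the two phases of Part 21), distinct ends have distinct corners, and
  `#strandEnds = 2L`.

Unit tests (`#eval` of `strandEnds`, session scratch `work/stubs/strandEnds/Test1/2.lean`; corner
`[(x,y),k]` = vertex `(x,y)`, face index `k`; all ends tracked, tag counts `2` each, corners
distinct, pairs `{m, m+1}` confirmed on 14 placements, four sides, L-shapes):
```
(2;2)   6×2, sink (3,0), source (1,0):  (3,0)S: -2→0  ends [(3,0),2,-2] [(3,0),3,-1]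
                                        (1,0)S:  0→-2 ends [(1,0),2,-1] [(1,0),3,-2]
(1;1)   6×2: (3,0)S: -1(w)→0  [(3,-1),0,-1];  (1,0)S: 0→-1(w)  [(1,-1),1,-1]
(1,1;2) 6×2: (3,0)S: -2→0 [(3,0),2,-2] [(3,0),3,-1]; (3,2)N: 0→-1(w) [(3,3),3,-1];
             (1,0)S: -1(w)→-2 [(1,-1),0,-2]
(1,1,1;3) 6×2, sink (4,0): (4,0)S: -3(w)→-2 [(4,-1),0,-3]; (5,0)S: -2→0 [(5,0),2,-2] [(5,0),3,-1];
             (3,2)N: 0→-1(w) [(3,3),3,-1]; (2,2)N: -1(w)→-2 [(2,3),2,-2]; (1,0)S: -2→-3(w) [(1,-1),1,-3]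
(2,1;3) 6×2: … (1,0)S: -1(w)→-2 (pending 1) [(1,-1),0,-2]; (2,0)S: -2→-3(w) [(2,-1),1,-3]
(2,3;5) 16×8 and (2,2,2;6), (1,2;3) on an L-shape: tags -L…-1 twice each, nested along the walk.
```
-/

namespace Summit.CriticalPhenomena.CardyFormulaZ2.Cruxes.BoundaryDefectGaussianR.RainbowMonomialsInExcursionKernels

open Literature.Probability.LatticeModels Literature.Probability.LatticeModels.CollarLegModel

/-! ### Discrete monotonicity and intermediate values -/

/-- Stepwise increase gives monotonicity with a gap. [folklore] -/
theorem se_mono_up (f : ℕ → ℤ) (T : ℕ) (hf : ∀ t, t < T → f t < f (t + 1)) :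
    ∀ u u', u ≤ u' → u' ≤ T → f u + (u' - u : ℕ) ≤ f u' := by
  intro u u' huu hu'
  induction u', huu using Nat.le_induction with
  | base => simp
  | succ u' huu ih =>
    have := ih (by omega)
    have h2 := hf u' (by omega)
    push_cast [Nat.succ_sub huu] at this ⊢
    omega

/-- Stepwise non-increase gives antitonicity. [folklore] -/
theorem se_mono_down (f : ℕ → ℤ) (T P : ℕ) (hf : ∀ t, T ≤ t → t < P → f (t + 1) ≤ f t) :
    ∀ u u', T ≤ u → u ≤ u' → u' ≤ P → f u' ≤ f u := by
  intro u u' hTu huu hu'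
  induction u', huu using Nat.le_induction with
  | base => exact le_rfl
  | succ u' huu ih => exact (hf u' (by omega) (by omega)).trans (ih (by omega))

/-- Discrete intermediate value, increasing phase. [folklore] -/
theorem se_ivt_up (f : ℕ → ℤ) (m : ℤ) (h0 : f 0 ≤ m) : ∀ T, m < f T → ∃ t, t < T ∧ f t ≤ m ∧ m < f (t + 1)
  | 0, hT => absurd h0 (not_le.2 hT)
  | T + 1, hT => by
    by_cases hm : m < f T
    · obtain ⟨t, ht, h1, h2⟩ := se_ivt_up f m h0 T hm
      exact ⟨t, by omega, h1, h2⟩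
    · exact ⟨T, by omega, not_lt.1 hm, hT⟩

/-- Discrete intermediate value, decreasing phase. [folklore] -/
theorem se_ivt_down (f : ℕ → ℤ) (m : ℤ) (T : ℕ) (hT : m < f T) :
    ∀ P, T ≤ P → f P ≤ m → ∃ t, T ≤ t ∧ t < P ∧ f (t + 1) ≤ m ∧ m < f t := by
  intro P hTP
  induction P, hTP using Nat.le_induction with
  | base => intro hP; exact absurd hP (not_le.2 hT)
  | succ P hTP ih =>
    intro hP
    by_cases hm : f P ≤ m
    · obtain ⟨t, h1, h2, h3, h4⟩ := ih hm
      exact ⟨t, h1, by omega, h3, h4⟩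
    · exact ⟨P, hTP, by omega, hP, not_le.1 hm⟩

/-! ## Part C: strand ends — the `endsAt` table, membership, tags -/

section EndsAt

open LegInsertionData

/-- No end where the level does not change. [folklore] -/
theorem se_endsAt_nil (d : Dart) (s s' : WalkState) (h0 : s'.level = s.level) : endsAt (d, s, s') = [] := by
  simp [endsAt, h0]

/-- The two ends at a jump edge. [folklore] -/
theorem se_endsAt_jump (d : Dart) (s s' : WalkState) (hj : s'.level = s.level + 2 ∨ s.level = s'.level + 2) :
    endsAt (d, s, s') = [((toSite d.1, d.2 + 3), min s.level ((s.level + s'.level) / 2)),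
      ((toSite d.1, d.2), min s'.level ((s.level + s'.level) / 2))] := by
  have hne : s'.level ≠ s.level := by omega
  rw [endsAt]
  simp only
  rw [if_neg hne, if_pos hj]

/-- The end at a junction. [folklore] -/
theorem se_endsAt_junction (d : Dart) (s s' : WalkState) (hne : s'.level ≠ s.level)
    (hnj : ¬ (s'.level = s.level + 2 ∨ s.level = s'.level + 2)) :
    endsAt (d, s, s') = if s.wired then [((toSite (dartTip d), d.2 + 1), min s.level s'.level)]
      else [((toSite (dartTip d), d.2 + 2), min s.level s'.level)] := by
  rw [endsAt]
  simp only
  rw [if_neg hne, if_neg hnj]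

/-- **Tags of the ends at one dart lie in `[min ℓ ℓ', max ℓ ℓ')`.** [folklore] -/
theorem se_endsAt_tag (d : Dart) (s s' : WalkState) {e : (Site 2 × Fin 4) × ℤ} (he : e ∈ endsAt (d, s, s')) :
    min s.level s'.level ≤ e.2 ∧ e.2 < max s.level s'.level := by
  by_cases h0 : s'.level = s.level
  · rw [se_endsAt_nil d s s' h0] at he; simp at he
  by_cases hj : s'.level = s.level + 2 ∨ s.level = s'.level + 2
  · rw [se_endsAt_jump d s s' hj] at he
    simp only [List.mem_cons, List.not_mem_nil, or_false] at he
    rcases he with rfl | rfl <;> simp only <;> omega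
  · rw [se_endsAt_junction d s s' h0 hj] at he
    split_ifs at he <;> simp only [List.mem_cons, List.not_mem_nil, or_false] at he <;> subst he <;>
      simp only <;> omega

/-- **Every tag in `[min ℓ ℓ', max ℓ ℓ')` occurs** when the level moves by one or two. [folklore] -/
theorem se_endsAt_tag_surj (d : Dart) (s s' : WalkState)
    (hΔ : s'.level = s.level + 1 ∨ s'.level = s.level - 1 ∨ s'.level = s.level + 2 ∨ s'.level = s.level - 2)
    {m : ℤ} (hm : min s.level s'.level ≤ m) (hm' : m < max s.level s'.level) :
    ∃ e ∈ endsAt (d, s, s'), e.2 = m := by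
  by_cases hj : s'.level = s.level + 2 ∨ s.level = s'.level + 2
  · rw [se_endsAt_jump d s s' hj]
    by_cases hm1 : m = min s.level ((s.level + s'.level) / 2)
    · exact ⟨_, List.mem_cons_self, hm1.symm⟩
    · refine ⟨_, List.mem_cons_of_mem _ List.mem_cons_self, ?_⟩
      simp only
      omega
  · have hne : s'.level ≠ s.level := by omega
    rw [se_endsAt_junction d s s' hne hj]
    split_ifs
    · exact ⟨_, List.mem_cons_self, by simp only; omega⟩
    · exact ⟨_, List.mem_cons_self, by simp only; omega⟩

/-- **The ends at one dart have distinct tags and distinct corners.** [folklore] -/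
theorem se_endsAt_inj (d : Dart) (s s' : WalkState) {e e' : (Site 2 × Fin 4) × ℤ} (he : e ∈ endsAt (d, s, s'))
    (he' : e' ∈ endsAt (d, s, s')) : (e.2 = e'.2 → e = e') ∧ (e.1 = e'.1 → e = e') := by
  by_cases h0 : s'.level = s.level
  · rw [se_endsAt_nil d s s' h0] at he; simp at he
  by_cases hj : s'.level = s.level + 2 ∨ s.level = s'.level + 2
  · rw [se_endsAt_jump d s s' hj] at he he'
    have h3 : d.2 + 3 ≠ d.2 := fin4_add_three_ne d.2
    simp only [List.mem_cons, List.not_mem_nil, or_false] at he he'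
    rcases he with rfl | rfl <;> rcases he' with rfl | rfl
    · exact ⟨fun _ => rfl, fun _ => rfl⟩
    · constructor
      · intro h; simp only at h; omega
      · intro h; simp only [Prod.mk.injEq] at h; exact absurd h.2 h3
    · constructor
      · intro h; simp only at h; omega
      · intro h; simp only [Prod.mk.injEq] at h; exact absurd h.2.symm h3
    · exact ⟨fun _ => rfl, fun _ => rfl⟩
  · rw [se_endsAt_junction d s s' h0 hj] at he he'
    split_ifs at he he' <;> simp only [List.mem_cons, List.not_mem_nil, or_false] at he he' <;> subst he he' <;>
      exact ⟨fun _ => rfl, fun _ => rfl⟩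

/-- **Where the corners of the ends sit.** At a jump edge the corners are at the vertex of the dart
(faces `k + 3` before and `k` after); at a junction the corner is at the ghost `dartTip d` (face
`k + 1` if the arc closes, `k + 2` if it opens) and the tag is `min ℓ ℓ'`. [folklore] -/
theorem se_endsAt_site (d : Dart) (s s' : WalkState) {e : (Site 2 × Fin 4) × ℤ} (he : e ∈ endsAt (d, s, s')) :
    ((s'.level = s.level + 2 ∨ s.level = s'.level + 2) ∧
      (e = ((toSite d.1, d.2 + 3), min s.level ((s.level + s'.level) / 2)) ∨
        e = ((toSite d.1, d.2), min s'.level ((s.level + s'.level) / 2)))) ∨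
    (¬ (s'.level = s.level + 2 ∨ s.level = s'.level + 2) ∧ s'.level ≠ s.level ∧
      ((s.wired = true ∧ e = ((toSite (dartTip d), d.2 + 1), min s.level s'.level)) ∨
        (s.wired = false ∧ e = ((toSite (dartTip d), d.2 + 2), min s.level s'.level)))) := by
  by_cases h0 : s'.level = s.level
  · rw [se_endsAt_nil d s s' h0] at he; simp at he
  by_cases hj : s'.level = s.level + 2 ∨ s.level = s'.level + 2
  · rw [se_endsAt_jump d s s' hj] at he
    simp only [List.mem_cons, List.not_mem_nil, or_false] at he
    exact Or.inl ⟨hj, he⟩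
  · rw [se_endsAt_junction d s s' h0 hj] at he
    right
    refine ⟨hj, h0, ?_⟩
    cases hw : s.wired
    · rw [hw] at he; simp only [Bool.false_eq_true, if_false, List.mem_cons, List.not_mem_nil, or_false] at he
      exact Or.inr ⟨rfl, he⟩
    · rw [hw] at he; simp only [if_true, List.mem_cons, List.not_mem_nil, or_false] at he
      exact Or.inl ⟨rfl, he⟩

end EndsAt


section Tags

variable (ι : LegInsertionData) (V : Finset (ℤ × ℤ)) {d₀ : Dart} (hadm : ι.IsAdmissible V)
  (h : outDart V ι.sink = some d₀) {st : ℕ → WalkState}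
  (hst : ∀ t, st t = List.foldl (fun s d => s.step (ι.startAt V d)) ι.init ((cycle V d₀).take t))

include h hst in
/-- **Membership in `strandEnds` by position**: an end is an end created at some dart `t` of the
walk, read with the states before and after it. [folklore] -/
theorem se_mem_strandEnds_iff {e : (Site 2 × Fin 4) × ℤ} :
    e ∈ ι.strandEnds V ↔ ∃ (t : ℕ) (_ : t < (cycle V d₀).length),
      e ∈ LegInsertionData.endsAt ((cycle V d₀)[t], st t, st (t + 1)) := by
  simp only [LegInsertionData.strandEnds, List.mem_toFinset, List.mem_flatMap]
  constructor
  · rintro ⟨T, hT, he⟩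
    obtain ⟨t, ht, rfl⟩ := (mem_walk_iff_st ι V h hst).1 hT
    exact ⟨t, ht, he⟩
  · rintro ⟨t, ht, he⟩
    exact ⟨_, (mem_walk_iff_st ι V h hst).2 ⟨t, ht, rfl⟩, he⟩

include hst in
/-- **The level change at an active dart** is `±1` (junction: wiredness flips) or `±2` (jump edge:
free on both sides). [folklore] -/
theorem se_active_delta {t : ℕ} (ht : t < (cycle V d₀).length) (hact : (st (t + 1)).level ≠ (st t).level) :
    ((st (t + 1)).level = (st t).level + 1 ∨ (st (t + 1)).level = (st t).level - 1 ∨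
      (st (t + 1)).level = (st t).level + 2 ∨ (st (t + 1)).level = (st t).level - 2) ∧
    (((st (t + 1)).level = (st t).level + 2 ∨ (st t).level = (st (t + 1)).level + 2) →
      (st t).wired = false ∧ (st (t + 1)).wired = false) ∧
    (¬ ((st (t + 1)).level = (st t).level + 2 ∨ (st t).level = (st (t + 1)).level + 2) →
      (st (t + 1)).wired = !(st t).wired) := by
  rcases st_step_cases ι V hst ht with ⟨hl, -⟩ | ⟨hsgn, hcase⟩
  · exact absurd hl hact
  · rcases hcase with ⟨hl, hw⟩ | ⟨hl, hw0, hw1⟩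
    · refine ⟨?_, fun hj => ?_, fun _ => hw⟩
      · rcases hsgn with hs | hs <;> rw [hl, hs] <;> omega
      · exfalso; rcases hsgn with hs | hs <;> rw [hs] at hl <;> omega
    · refine ⟨?_, fun _ => ⟨hw0, hw1⟩, fun hj => ?_⟩
      · rcases hsgn with hs | hs <;> rw [hl, hs] <;> omega
      · exfalso; apply hj; rcases hsgn with hs | hs <;> rw [hl, hs] <;> omega

include hadm h hst in
/-- **The corner of an end determines the dart that created it**: ends created at different darts
sit at different lattice points (rail vertices are met once, ghosts belong to one rail dart, and a
rail vertex is never a ghost). [folklore] -/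
theorem se_end_index_inj
    (hflat : ∀ x ∈ insert ι.sink ι.source, ∃ d : ℤ × ℤ, (d = (1, 0) ∨ d = (-1, 0) ∨ d = (0, 1) ∨ d = (0, -1)) ∧
      ∀ v : ℤ × ℤ, (v.1 - x.1) ^ 2 + (v.2 - x.2) ^ 2 ≤ ((ι.sinkLegs : ℤ) + 3) ^ 2 →
        (v ∈ V ↔ 0 ≤ (v.1 - x.1) * d.1 + (v.2 - x.2) * d.2))
    {t t' : ℕ} (ht : t < (cycle V d₀).length) (ht' : t' < (cycle V d₀).length)
    {e e' : (Site 2 × Fin 4) × ℤ} (he : e ∈ LegInsertionData.endsAt ((cycle V d₀)[t], st t, st (t + 1)))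
    (he' : e' ∈ LegInsertionData.endsAt ((cycle V d₀)[t'], st t', st (t' + 1))) (hc : e.1.1 = e'.1.1) :
    t = t' := by
  have hact : (st (t + 1)).level ≠ (st t).level := fun h0 => by
    rw [se_endsAt_nil _ _ _ h0] at he; simp at he
  have hact' : (st (t' + 1)).level ≠ (st t').level := fun h0 => by
    rw [se_endsAt_nil _ _ _ h0] at he'; simp at he'
  obtain ⟨c, K, hch, -, hds, -, -⟩ := se_active_rail ι V hadm h hst hflat ht hact
  obtain ⟨c', K', hch', -, hds', -, -⟩ := se_active_rail ι V hadm h hst hflat ht' hact'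
  have hext := se_cycle_exterior ι V hadm h ht
  have hext' := se_cycle_exterior ι V hadm h ht'
  rw [hds] at hext he
  rw [hds'] at hext' he'
  apply se_cycle_index_inj ι V hadm h ht ht'
  rw [hds, hds']
  rcases se_endsAt_site _ _ _ he with ⟨-, hE⟩ | ⟨-, -, hE⟩ <;>
    rcases se_endsAt_site _ _ _ he' with ⟨-, hE'⟩ | ⟨-, -, hE'⟩
  · have h1 : e.1.1 = toSite c := by rcases hE with rfl | rfl <;> rfl
    have h2 : e'.1.1 = toSite c' := by rcases hE' with rfl | rfl <;> rfl
    have hcc : c' = c := toSite_inj.1 (by rw [← h1, ← h2, hc])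
    exact (se_rail_dart_unique hch (d := (c', K')) hcc hext'.2).symm
  · exfalso
    have h1 : e.1.1 = toSite c := by rcases hE with rfl | rfl <;> rfl
    have h2 : e'.1.1 = toSite (dartTip (c', K')) := by rcases hE' with ⟨-, rfl⟩ | ⟨-, rfl⟩ <;> rfl
    have hcc : dartTip (c', K') = c := toSite_inj.1 (by rw [← h1, ← h2, hc])
    exact hext'.2 (hcc ▸ hext.1)
  · exfalso
    have h1 : e.1.1 = toSite (dartTip (c, K)) := by rcases hE with ⟨-, rfl⟩ | ⟨-, rfl⟩ <;> rfl
    have h2 : e'.1.1 = toSite c' := by rcases hE' with rfl | rfl <;> rfl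
    have hcc : dartTip (c, K) = c' := toSite_inj.1 (by rw [← h1, ← h2, hc])
    exact hext.2 (hcc ▸ hext'.1)
  · have h1 : e.1.1 = toSite (dartTip (c, K)) := by rcases hE with ⟨-, rfl⟩ | ⟨-, rfl⟩ <;> rfl
    have h2 : e'.1.1 = toSite (dartTip (c', K')) := by rcases hE' with ⟨-, rfl⟩ | ⟨-, rfl⟩ <;> rfl
    have hcc : dartTip (c', K') = dartTip (c, K) := toSite_inj.1 (by rw [← h1, ← h2, hc])
    exact (se_rail_tip_unique hch (d := (c', K')) hext'.1 hcc).symm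

include hadm h hst in
/-- **The tags of the strand ends** (positional form of `s14_strandEnds_tags`). [folklore] -/
theorem se_tags_main
    (hflat : ∀ x ∈ insert ι.sink ι.source, ∃ d : ℤ × ℤ, (d = (1, 0) ∨ d = (-1, 0) ∨ d = (0, 1) ∨ d = (0, -1)) ∧
      ∀ v : ℤ × ℤ, (v.1 - x.1) ^ 2 + (v.2 - x.2) ^ 2 ≤ ((ι.sinkLegs : ℤ) + 3) ^ 2 →
        (v ∈ V ↔ 0 ≤ (v.1 - x.1) * d.1 + (v.2 - x.2) * d.2)) :
    (∀ e ∈ ι.strandEnds V, -(ι.sinkLegs : ℤ) ≤ e.2 ∧ e.2 ≤ -1) ∧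
    (∀ m : ℤ, -(ι.sinkLegs : ℤ) ≤ m → m ≤ -1 → ((ι.strandEnds V).filter (fun e => e.2 = m)).card = 2) ∧
    (∀ e ∈ ι.strandEnds V, ∀ e' ∈ ι.strandEnds V, e.1 = e'.1 → e = e') ∧
    (ι.strandEnds V).card = 2 * ι.sinkLegs := by
  classical
  have hP := length_cycle_pos ι V hadm h
  have h1 : ∀ e ∈ ι.strandEnds V, -(ι.sinkLegs : ℤ) ≤ e.2 ∧ e.2 ≤ -1 := by
    intro e he
    obtain ⟨t, ht, he⟩ := (se_mem_strandEnds_iff ι V h hst).1 he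
    have htag := se_endsAt_tag _ _ _ he
    have hl0 := st_level_mem ι V hadm h hst (t := t) ht.le
    have hl1 := st_level_mem ι V hadm h hst (t := t + 1) ht
    constructor
    · exact le_trans (le_min hl0.1 hl1.1) htag.1
    · have := lt_of_lt_of_le htag.2 (max_le hl0.2 hl1.2); omega
  have h3 : ∀ e ∈ ι.strandEnds V, ∀ e' ∈ ι.strandEnds V, e.1 = e'.1 → e = e' := by
    intro e he e' he' hc
    obtain ⟨t, ht, hte⟩ := (se_mem_strandEnds_iff ι V h hst).1 he
    obtain ⟨t', ht', hte'⟩ := (se_mem_strandEnds_iff ι V h hst).1 he'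
    obtain rfl := se_end_index_inj ι V hadm h hst hflat ht ht' hte hte' (by rw [hc])
    exact (se_endsAt_inj _ _ _ hte hte').2 hc
  obtain ⟨T₀, hT1, hTP, hT0, hup, hdown⟩ := se_phases ι V hadm h hst
  have hlev0 : (st 0).level = -(ι.sinkLegs : ℤ) := by rw [hst 0]; rfl
  obtain ⟨hlevP, -, -⟩ := st_final ι V hadm h hst
  have hmu := se_mono_up (fun t => (st t).level) T₀ hup
  have hmd := se_mono_down (fun t => (st t).level) T₀ (cycle V d₀).length hdown
  have h2 : ∀ m : ℤ, -(ι.sinkLegs : ℤ) ≤ m → m ≤ -1 →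
      ((ι.strandEnds V).filter (fun e => e.2 = m)).card = 2 := by
    intro m hm1 hm2
    obtain ⟨tu, htu, hu1, hu2⟩ := se_ivt_up (fun t => (st t).level) m (by omega) T₀ (by omega)
    obtain ⟨td, htd1, htd2, hd1, hd2⟩ := se_ivt_down (fun t => (st t).level) m T₀ (by omega)
      (cycle V d₀).length hTP (by omega)
    have htuP : tu < (cycle V d₀).length := by omega
    have hactu : (st (tu + 1)).level ≠ (st tu).level := by omega
    have hactd : (st (td + 1)).level ≠ (st td).level := by omega
    obtain ⟨eu, heu, heum⟩ := se_endsAt_tag_surj (cycle V d₀)[tu] (st tu) (st (tu + 1))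
      (se_active_delta ι V hst htuP hactu).1 (le_trans (min_le_left _ _) hu1) (lt_of_lt_of_le hu2 (le_max_right _ _))
    obtain ⟨ed, hed, hedm⟩ := se_endsAt_tag_surj (cycle V d₀)[td] (st td) (st (td + 1))
      (se_active_delta ι V hst htd2 hactd).1 (le_trans (min_le_right _ _) hd1) (lt_of_lt_of_le hd2 (le_max_left _ _))
    have heuS : eu ∈ ι.strandEnds V := (se_mem_strandEnds_iff ι V h hst).2 ⟨tu, htuP, heu⟩
    have hedS : ed ∈ ι.strandEnds V := (se_mem_strandEnds_iff ι V h hst).2 ⟨td, htd2, hed⟩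
    have hne : eu ≠ ed := by
      intro heq
      have := se_end_index_inj ι V hadm h hst hflat htuP htd2 heu hed (by rw [heq])
      omega
    have hsub : (ι.strandEnds V).filter (fun e => e.2 = m) = {eu, ed} := by
      ext e
      simp only [Finset.mem_filter, Finset.mem_insert, Finset.mem_singleton]
      constructor
      · rintro ⟨heS, hem⟩
        obtain ⟨t, ht, hte⟩ := (se_mem_strandEnds_iff ι V h hst).1 heS
        have htag := se_endsAt_tag _ _ _ hte
        rw [hem] at htag
        have hact : (st (t + 1)).level ≠ (st t).level := fun h0 => by
          rw [se_endsAt_nil _ _ _ h0] at hte; simp at hte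
        by_cases htT : t < T₀
        · have hlt := hup t htT
          rw [min_eq_left hlt.le, max_eq_right hlt.le] at htag
          have htt : t = tu := by
            by_contra hne'
            rcases lt_or_gt_of_ne hne' with hlt' | hgt
            · have := hmu (t + 1) tu hlt' htu.le
              omega
            · have := hmu (tu + 1) t hgt htT.le
              omega
          subst htt
          left; exact (se_endsAt_inj _ _ _ hte heu).1 (hem.trans heum.symm)
        · push Not at htT
          have hle := hdown t htT ht
          have hlt : (st (t + 1)).level < (st t).level := lt_of_le_of_ne hle hact
          rw [min_eq_right hlt.le, max_eq_left hlt.le] at htag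
          have htt : t = td := by
            by_contra hne'
            rcases lt_or_gt_of_ne hne' with hlt' | hgt
            · have := hmd (t + 1) td (by omega) (by omega) htd2.le
              omega
            · have := hmd (td + 1) t (by omega) (by omega) ht.le
              omega
          subst htt
          right; exact (se_endsAt_inj _ _ _ hte hed).1 (hem.trans hedm.symm)
      · rintro (rfl | rfl)
        · exact ⟨heuS, heum⟩
        · exact ⟨hedS, hedm⟩
    rw [hsub, Finset.card_pair hne]
  refine ⟨h1, h2, h3, ?_⟩
  rw [Finset.card_eq_sum_card_fiberwise (f := fun e : (Site 2 × Fin 4) × ℤ => e.2) (s := ι.strandEnds V)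
    (t := Finset.Icc (-(ι.sinkLegs : ℤ)) (-1))
    (fun e he => Finset.mem_coe.2 (Finset.mem_Icc.2 (h1 e (Finset.mem_coe.1 he))))]
  rw [Finset.sum_congr rfl (fun m hm => h2 m (Finset.mem_Icc.1 hm).1 (Finset.mem_Icc.1 hm).2), Finset.sum_const,
    Int.card_Icc, smul_eq_mul]
  have : (-1 + 1 - -(ι.sinkLegs : ℤ)).toNat = ι.sinkLegs := by simp
  rw [this, Nat.mul_comm]

end Tags

/-- **Sub-goal `s14_strandEnds_tags`** (registered on stmt-CriticalPhenomena-14132): for an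
admissible leg insertion whose insertion points are flat to radius `L + 3` (`L = sinkLegs`), the
tags of the strand ends `LegInsertionData.strandEnds` are exactly the integers `-L ≤ m ≤ -1`, each
carried by exactly two ends; distinct ends sit at distinct corners; there are `2L` ends. [folklore] -/
theorem s14_strandEnds_tags : ∀ (ι : Literature.Probability.LatticeModels.CollarLegModel.LegInsertionData) (V : Finset (ℤ × ℤ)), ι.IsAdmissible V → (∀ x ∈ insert ι.sink ι.source, ∃ d : ℤ × ℤ, (d = (1, 0) ∨ d = (-1, 0) ∨ d = (0, 1) ∨ d = (0, -1)) ∧ ∀ v : ℤ × ℤ, (v.1 - x.1) ^ 2 + (v.2 - x.2) ^ 2 ≤ ((ι.sinkLegs : ℤ) + 3) ^ 2 → (v ∈ V ↔ 0 ≤ (v.1 - x.1) * d.1 + (v.2 - x.2) * d.2)) → (∀ e ∈ ι.strandEnds V, -(ι.sinkLegs : ℤ) ≤ e.2 ∧ e.2 ≤ -1) ∧ (∀ m : ℤ, -(ι.sinkLegs : ℤ) ≤ m → m ≤ -1 → ((ι.strandEnds V).filter (fun e => e.2 = m)).card = 2) ∧ (∀ e ∈ ι.strandEnds V, ∀ e'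 ∈ ι.strandEnds V, e.1 = e'.1 → e = e') ∧ (ι.strandEnds V).card = 2 * ι.sinkLegs := by
  intro ι V hadm hflat
  obtain ⟨d₀, h, -⟩ := s3_of_admissible ι V hadm
  exact se_tags_main ι V hadm h (st := fun t => List.foldl (fun s d => s.step (ι.startAt V d)) ι.init ((cycle V d₀).take t))
    (fun _ => rfl) hflat

end Summit.CriticalPhenomena.CardyFormulaZ2.Cruxes.BoundaryDefectGaussianR.RainbowMonomialsInExcursionKernels
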